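import Literature.NumberTheory.GaloisRepresentations.RestrictionCalculus
import Mathlib.Topology.Algebra.IsUniformGroup.DiscreteSubgroup
import HarnessLib

/-!
# Restriction of cochains along inclusions of subgroups `T ≤ H ≤ Γ`

For a discrete `Γ`-module `ρ` and subgroups `T ≤ H` of a topological group `Γ`, the groups
`T`, `H` and `T ∩ H ≤ H` (`T.subgroupOf H`) all carry restrictions of `ρ`; this file names the
continuous inclusions between them and records that "the restriction of a cochain of `H` to `T`
is a coboundary" does not depend on whether `T` is viewed as a group in its own right
(`resIncl`) or as the subgroup `T.subgroupOf H` of `H` (Mathlib's `cochainsMap` along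
`subgroupIncl`): `exists_d_eq_subgroupOf_of_incl`, `exists_d_eq_incl_of_subgroupOf`, and the
transitivity `resIncl_comp_apply`.  Pure bookkeeping (`cochainsMap_comp_apply_of`) for the
dévissage in the proof of Serre II §3.1 Prop. 5
(`Literature.NumberTheory.GaloisRepresentations.tsen_fieldCdLE_one_of_trdeg_eq_one`).

## References

* J.-P. Serre, *Cohomologie galoisienne* (1997), I §2.4 (compatible pairs).
  [SerreGaloisCohomology1997]
-/

noncomputable section

open CategoryTheory Topology

universe u

namespace Literature.NumberTheory.GaloisRepresentations

open _root_.TopRep _root_.ContRepresentation _root_.ContinuousCohomology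

variable {k : Type*} [CommRing k] [TopologicalSpace k]
variable {Γ : Type u} [Group Γ] [TopologicalSpace Γ] [IsTopologicalGroup Γ]
variable {M : Type u} [AddCommGroup M] [Module k M] [TopologicalSpace M] [DiscreteTopology M]
  [ContinuousSMul k M]
variable (ρ : ContinuousRep Γ k M) {T H : Subgroup Γ}

/-- The inclusion `T → H` of subgroups `T ≤ H`, as a continuous homomorphism (the same term as
the tree's `Literature.NumberTheory.EllipticCurves.subgroupInclusion` in `SubgroupSelmer.lean`,
kept topic-local like `subgroupIncl`; a librarian may merge the two). [folklore] -/
def inclCMH (h : T ≤ H) : T →ₜ* H := ⟨Subgroup.inclusion h, continuous_inclusion h⟩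

omit [IsTopologicalGroup Γ] in
/-- `inclCMH h x = x`. [folklore] -/
@[simp] theorem coe_inclCMH_apply (h : T ≤ H) (x : T) : ((inclCMH h x : H) : Γ) = x := rfl

/-- The identity `ρ|_H restricted along T → H  =  ρ|_T`, as a morphism. [folklore] -/
def inclRepHom (h : T ≤ H) :
    TopRep.res (inclCMH h : T →* H) (ρ.restrict (subgroupIncl H)).toTopRep ⟶
      (ρ.restrict (subgroupIncl T)).toTopRep :=
  TopRep.ofHom ⟨ContinuousLinearMap.id k M, fun _ => rfl⟩

/-- **Restriction of cochains of `H` to a subgroup `T ≤ H` viewed as a group** (`cochainsMap`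
along `inclCMH`). [folklore] -/
abbrev resIncl (h : T ≤ H) :
    homogeneousCochains (ρ.restrict (subgroupIncl H)).toTopRep ⟶
      homogeneousCochains (ρ.restrict (subgroupIncl T)).toTopRep :=
  cochainsMap (inclCMH h) (inclRepHom ρ h)

/-- `T ∩ H ≤ H → T` as a continuous homomorphism: the forward direction of Mathlib's
`Subgroup.subgroupOfContinuousMulEquivOfLe h : T.subgroupOf H ≃ₜ* T`. [folklore] -/
abbrev ofSubgroupOfCMH (h : T ≤ H) : T.subgroupOf H →ₜ* T :=
  (Subgroup.subgroupOfContinuousMulEquivOfLe h : T.subgroupOf H →ₜ* T)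

/-- `T → T ∩ H ≤ H` as a continuous homomorphism: the inverse direction of Mathlib's
`Subgroup.subgroupOfContinuousMulEquivOfLe h`. [folklore] -/
abbrev toSubgroupOfCMH (h : T ≤ H) : T →ₜ* T.subgroupOf H :=
  ((Subgroup.subgroupOfContinuousMulEquivOfLe h).symm : T →ₜ* T.subgroupOf H)

/-- The identity of modules over `T ∩ H ≅ T`, one way. [folklore] -/
def ofSubgroupOfRepHom (h : T ≤ H) :
    TopRep.res (ofSubgroupOfCMH h : T.subgroupOf H →* T) (ρ.restrict (subgroupIncl T)).toTopRep ⟶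
      ((ρ.restrict (subgroupIncl H)).restrict (subgroupIncl (T.subgroupOf H))).toTopRep :=
  TopRep.ofHom ⟨ContinuousLinearMap.id k M, fun _ => rfl⟩

/-- The identity of modules over `T ≅ T ∩ H`, the other way. [folklore] -/
def toSubgroupOfRepHom (h : T ≤ H) :
    TopRep.res (toSubgroupOfCMH h : T →* T.subgroupOf H)
        ((ρ.restrict (subgroupIncl H)).restrict (subgroupIncl (T.subgroupOf H))).toTopRep ⟶
      (ρ.restrict (subgroupIncl T)).toTopRep :=
  TopRep.ofHom ⟨ContinuousLinearMap.id k M, fun _ => rfl⟩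

/-- **From `T` to `T.subgroupOf H`**: if the restriction of `a` to the group `T` is a coboundary,
so is its restriction to the subgroup `T ∩ H` of `H`. [folklore] -/
theorem exists_d_eq_subgroupOf_of_incl (h : T ≤ H) (n : ℕ)
    (a : (homogeneousCochains (ρ.restrict (subgroupIncl H)).toTopRep).X (n + 1))
    (hT : ∃ z : (homogeneousCochains (ρ.restrict (subgroupIncl T)).toTopRep).X n,
      (homogeneousCochains (ρ.restrict (subgroupIncl T)).toTopRep).d n (n + 1) z =
        (resIncl ρ h).f (n + 1) a) :
    ∃ z : (homogeneousCochains ((ρ.restrict (subgroupIncl H)).restrict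
        (subgroupIncl (T.subgroupOf H))).toTopRep).X n,
      (homogeneousCochains ((ρ.restrict (subgroupIncl H)).restrict
        (subgroupIncl (T.subgroupOf H))).toTopRep).d n (n + 1) z =
      (cochainsMap (subgroupIncl (T.subgroupOf H))
        (𝟙 ((ρ.restrict (subgroupIncl H)).restrict (subgroupIncl (T.subgroupOf H))).toTopRep)).f
        (n + 1) a :=
  exists_d_eq_cochainsMap_of (inclCMH h) (ofSubgroupOfCMH h) (subgroupIncl (T.subgroupOf H))
    (fun _ => rfl) (inclRepHom ρ h) (ofSubgroupOfRepHom ρ h) (𝟙 _) (fun _ => rfl) n a hT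

/-- **From `T.subgroupOf H` to `T`**: the converse conversion. [folklore] -/
theorem exists_d_eq_incl_of_subgroupOf (h : T ≤ H) (n : ℕ)
    (a : (homogeneousCochains (ρ.restrict (subgroupIncl H)).toTopRep).X (n + 1))
    (hT : ∃ z : (homogeneousCochains ((ρ.restrict (subgroupIncl H)).restrict
        (subgroupIncl (T.subgroupOf H))).toTopRep).X n,
      (homogeneousCochains ((ρ.restrict (subgroupIncl H)).restrict
        (subgroupIncl (T.subgroupOf H))).toTopRep).d n (n + 1) z =
      (cochainsMap (subgroupIncl (T.subgroupOf H))
        (𝟙 ((ρ.restrict (subgroupIncl H)).restrict (subgroupIncl (T.subgroupOf H))).toTopRep)).f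
        (n + 1) a) :
    ∃ z : (homogeneousCochains (ρ.restrict (subgroupIncl T)).toTopRep).X n,
      (homogeneousCochains (ρ.restrict (subgroupIncl T)).toTopRep).d n (n + 1) z =
        (resIncl ρ h).f (n + 1) a :=
  exists_d_eq_cochainsMap_of (subgroupIncl (T.subgroupOf H)) (toSubgroupOfCMH h) (inclCMH h)
    (fun _ => rfl) (𝟙 _) (toSubgroupOfRepHom ρ h) (inclRepHom ρ h) (fun _ => rfl) n a hT

/-- **Transitivity of restriction**: for `T' ≤ T ≤ H`, restricting from `H` to `T'` is restricting
to `T` and then to `T'`, on elements. [folklore] -/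
theorem resIncl_comp_apply {T' : Subgroup Γ} (h' : T' ≤ T) (h : T ≤ H) (i : ℕ)
    (a : (homogeneousCochains (ρ.restrict (subgroupIncl H)).toTopRep).X i) :
    (resIncl ρ (h'.trans h)).f i a = (resIncl ρ h').f i ((resIncl ρ h).f i a) :=
  cochainsMap_comp_apply_of (inclCMH h) (inclCMH h') (inclCMH (h'.trans h)) (fun _ => rfl)
    (inclRepHom ρ h) (inclRepHom ρ h') (inclRepHom ρ (h'.trans h)) (fun _ => rfl) i a

/-- Restriction commutes with the differentials (a coboundary restricts to a coboundary).
[folklore] -/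
theorem resIncl_d_apply (h : T ≤ H) (i j : ℕ)
    (b : (homogeneousCochains (ρ.restrict (subgroupIncl H)).toTopRep).X i) :
    (resIncl ρ h).f j ((homogeneousCochains (ρ.restrict (subgroupIncl H)).toTopRep).d i j b) =
      (homogeneousCochains (ρ.restrict (subgroupIncl T)).toTopRep).d i j ((resIncl ρ h).f i b) :=
  (hom_f_d_apply (resIncl ρ h) i j b).symm

end Literature.NumberTheory.GaloisRepresentations

end
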